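import Literature.Geometry.Lorentzian.WeightedNormsProofs
import Mathlib.MeasureTheory.Function.Jacobian
import Mathlib.Analysis.Calculus.ContDiff.Bounds
import Mathlib.Analysis.Calculus.FDeriv.Measurable
import Mathlib.Algebra.Order.Chebyshev
import HarnessLib

/-!
# `BulkKerrCaptureC2` — spin transport III: weighted Sobolev seminorms under compactly supported transport

Crux `stmt-FinalStateConjecture-14985`
(`Summit.FinalStateConjecture.FinalStateConjecture.Theses.PhaseMixingCapture.BulkKerrCaptureC2`, rank 4 of
`route-FinalStateConjecture-PhaseMixingCapture`). Helper file (`--supports`), closes nothing by itself. Third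
file of the SPIN TRANSPORT package (see `…SpinPerturbation` for the headline); pure analysis, no Kerr geometry.

**The transport estimate** (`weightedSobolevSeminorm_transport_le`). Let `Γ : ℝ³ → ℝ³` be smooth, the
identity off the ball `‖y‖ < R`, injective on an open `U₁` which it maps into an open `U₂`, with `‖DⁱΓ‖ ≤ Bⁱ`
(`1 ≤ i ≤ s`), `|det DΓ| ≥ 1/2` and `Γ(B̄_R) ⊆ B̄_{R'}`; let `Λ : ℝ³ → (G →L G)` be a smooth multiplier equal
to `1` off the same ball with `‖DⁱΛ‖ ≤ A` (`i ≤ s`). Then for every `f` smooth on `U₂`,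
`‖y ↦ Λ(y) f(Γ y)‖_{H^s_δ(U₁)} ≤ K ‖f‖_{H^s_δ(U₂)}` with `K = K(s, δ, R, R', B, A)` INDEPENDENT of
`Γ, Λ, U₁, U₂, f` (Bartnik's `weightedSobolevSeminorm`, Bartnik 1986, (1.2)): off the ball the integrands agree;
on it the weights are bounded above and below, `Dᵐ` of the transported function is controlled LINEARLY in
`max_{j ≤ m} ‖Dʲf(Γ y)‖` by the Leibniz rule (`ContinuousLinearMap.norm_iteratedFDerivWithin_le_of_bilinear`)
and Faà di Bruno (`norm_iteratedFDerivWithin_comp_le`), and the change of variables `x = Γ y` costs a factor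
`2` (`MeasureTheory.lintegral_image_eq_lintegral_abs_det_fderiv_mul`). This is the form in which pull-backs of
perturbed data along the slice identifications of `…SpinSlices` stay in the data ball: the components of
`Φ^* D` are `h(D)(Γ y) ∘ (DΓ × DΓ)`, i.e. `Λ(y) = (T ↦ T ∘ (DΓ(y) × DΓ(y)))`.

Everything is proved; no definitions, no named facts.
-/

-- the doubled `FinalStateConjecture.FinalStateConjecture` path component trips dupNamespace
set_option linter.dupNamespace false
-- iterated operator-norm spaces over `E3` (values of `hFun`/`kFun`): nested instance searches through `PiLp`
set_option maxSynthPendingDepth 3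

noncomputable section
open Set Filter Function Metric MeasureTheory Topology
open scoped ContDiff Topology ENNReal NNReal Nat
namespace Summit.FinalStateConjecture.FinalStateConjecture.Theorems.BulkKerrCaptureC2.SpinTransport

open Literature.Geometry.Lorentzian
variable {G : Type*} [NormedAddCommGroup G] [NormedSpace ℝ G]
/-! ## §1 Weights on balls; continuity of iterated derivatives on open sets -/
/-- On the ball `‖y‖ ≤ R` the Bartnik weight `(1 + ‖y‖)^p` is at most `(1 + R)^{|p|}`. [folklore] -/
theorem one_add_norm_rpow_le_of_norm_le {R : ℝ} (hR : 0 ≤ R) {y : E3} (hy : ‖y‖ ≤ R) (p : ℝ) :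
    (1 + ‖y‖) ^ p ≤ (1 + R) ^ |p| := by
  have h1 : (1 : ℝ) ≤ 1 + ‖y‖ := le_add_of_nonneg_right (norm_nonneg y)
  have h2 : 1 + ‖y‖ ≤ 1 + R := by linarith
  rcases le_or_gt 0 p with hp | hp
  · rw [abs_of_nonneg hp]
    exact Real.rpow_le_rpow (by positivity) h2 hp
  · rw [abs_of_neg hp]
    calc (1 + ‖y‖) ^ p ≤ (1 + ‖y‖) ^ (0 : ℝ) := Real.rpow_le_rpow_of_exponent_le h1 hp.le
      _ = 1 := Real.rpow_zero _
      _ ≤ (1 + R) ^ (-p) := Real.one_le_rpow (by linarith) (by linarith)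

/-- On the ball `‖y‖ ≤ R` the Bartnik weight `(1 + ‖y‖)^p` is at least `(1 + R)^{-|p|} > 0`. [folklore] -/
theorem rpow_neg_abs_le_one_add_norm_rpow {R : ℝ} (hR : 0 ≤ R) {y : E3} (hy : ‖y‖ ≤ R) (p : ℝ) :
    (1 + R) ^ (-|p|) ≤ (1 + ‖y‖) ^ p := by
  have h := one_add_norm_rpow_le_of_norm_le hR hy (-p)
  rw [abs_neg] at h
  have hpos : 0 < (1 + ‖y‖) ^ (-p) := Real.rpow_pos_of_pos (by positivity) _
  have hpos' : 0 < (1 + R) ^ |p| := Real.rpow_pos_of_pos (by linarith) _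
  rw [Real.rpow_neg (by linarith), inv_le_comm₀ hpos' (Real.rpow_pos_of_pos (by positivity) _),
    ← Real.rpow_neg (by positivity)]
  exact h

/-- Iterated derivatives of a function smooth on an open set are continuous there. [folklore] -/
theorem continuousOn_iteratedFDeriv_of_isOpen {U : Set E3} (hU : IsOpen U) {f : E3 → G}
    (hf : ContDiffOn ℝ ∞ f U) (m : ℕ) : ContinuousOn (iteratedFDeriv ℝ m f) U :=
  (hf.continuousOn_iteratedFDerivWithin (by exact_mod_cast le_top) hU.uniqueDiffOn).congr
    fun x hx ↦ (iteratedFDerivWithin_of_isOpen m hU hx).symm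

/-! ## §2 The transported function off and on the ball -/
section Pointwise

variable {U₁ U₂ : Set E3} {Γ : E3 → E3} {Λ : E3 → G →L[ℝ] G} {f : E3 → G} {R : ℝ}

/-- **Off the ball the transported function is the original one**: `Dᵐ[y ↦ Λ(y) f(Γ y)](y) = Dᵐf(y)` for
`R < ‖y‖` if `Γ = id` and `Λ = 1` on `{R ≤ ‖·‖}` (the functions agree on an open set). [folklore] -/
theorem iteratedFDeriv_transport_eq_of_lt_norm (hΓ : ∀ y, R ≤ ‖y‖ → Γ y = y)
    (hΛ : ∀ y, R ≤ ‖y‖ → Λ y = ContinuousLinearMap.id ℝ G) {y : E3} (hy : R < ‖y‖) (m : ℕ) :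
    iteratedFDeriv ℝ m (fun y ↦ Λ y (f (Γ y))) y = iteratedFDeriv ℝ m f y := by
  have hO : IsOpen {z : E3 | R < ‖z‖} := isOpen_lt continuous_const continuous_norm
  have heq : (fun y ↦ Λ y (f (Γ y))) =ᶠ[𝓝 y] f := by
    filter_upwards [hO.mem_nhds hy] with z hz
    rw [hΓ z (le_of_lt hz), hΛ z (le_of_lt hz), ContinuousLinearMap.id_apply]
  exact (heq.iteratedFDeriv ℝ m).eq_of_nhds

/-- **Pointwise control of the transported function, LINEAR in `f`**: for `y ∈ U₁`, `m ≤ s`,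
`‖Dᵐ[Λ · (f ∘ Γ)](y)‖ ≤ A (m+1) 2ᵐ m! Bᵐ · ∑_{j ≤ m} ‖Dʲf(Γ y)‖` (Leibniz rule for the pairing `(Λ, v) ↦ Λ v`,
then Faà di Bruno for `f ∘ Γ`; hypotheses as in the module docstring). [folklore] -/
theorem norm_iteratedFDeriv_transport_le (hU₁ : IsOpen U₁) (hU₂ : IsOpen U₂) (hΓs : ContDiff ℝ ∞ Γ)
    (hmaps : MapsTo Γ U₁ U₂) {B : ℝ} (hB : 1 ≤ B) {s : ℕ}
    (hBΓ : ∀ i, 1 ≤ i → i ≤ s → ∀ y, ‖iteratedFDeriv ℝ i Γ y‖ ≤ B ^ i) (hΛs : ContDiff ℝ ∞ Λ) {A : ℝ}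
    (hA : 0 ≤ A) (hAΛ : ∀ i, i ≤ s → ∀ y, ‖iteratedFDeriv ℝ i Λ y‖ ≤ A) (hf : ContDiffOn ℝ ∞ f U₂) {y : E3}
    (hy : y ∈ U₁) {m : ℕ} (hm : m ≤ s) :
    ‖iteratedFDeriv ℝ m (fun y ↦ Λ y (f (Γ y))) y‖ ≤
      A * ((m + 1) * (2 ^ m * (m ! * B ^ m))) * ∑ j ∈ Finset.range (m + 1), ‖iteratedFDeriv ℝ j f (Γ y)‖ := by
  set g : E3 → G := fun y ↦ f (Γ y) with hg_def
  have hg : ContDiffOn ℝ ∞ g U₁ := hf.comp hΓs.contDiffOn hmaps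
  have hΛon : ContDiffOn ℝ ∞ Λ U₁ := hΛs.contDiffOn
  have hmN : (m : ℕ∞ω) ≤ ((⊤ : ℕ∞) : ℕ∞ω) := by exact_mod_cast le_top
  set Cf : ℝ := ∑ j ∈ Finset.range (m + 1), ‖iteratedFDeriv ℝ j f (Γ y)‖ with hCf
  have hCf0 : 0 ≤ Cf := Finset.sum_nonneg fun j _ ↦ norm_nonneg _
  -- Leibniz for the pairing `(Λ, v) ↦ Λ v`, i.e. the bilinear map `id : (G →L G) →L (G →L G)`
  have hLeib := ContinuousLinearMap.norm_iteratedFDerivWithin_le_of_bilinear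
    (ContinuousLinearMap.id ℝ (G →L[ℝ] G)) hΛon hg hU₁.uniqueDiffOn hy hmN
  simp only [ContinuousLinearMap.coe_id', id_eq] at hLeib
  rw [iteratedFDerivWithin_of_isOpen m hU₁ hy] at hLeib
  -- Faà di Bruno for `g = f ∘ Γ`, at every order `n ≤ m`
  have hFdB : ∀ n, n ≤ m → ‖iteratedFDeriv ℝ n g y‖ ≤ n ! * Cf * B ^ n := fun n hn ↦ by
    have hnN : (n : ℕ∞ω) ≤ ((⊤ : ℕ∞) : ℕ∞ω) := by exact_mod_cast le_top
    have h := norm_iteratedFDerivWithin_comp_le (g := f) (f := Γ) (n := n) (s := U₁) (t := U₂) (x := y)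
      hf hΓs.contDiffOn hnN hU₂.uniqueDiffOn hU₁.uniqueDiffOn hmaps hy
      (C := Cf) (D := B) (fun i hi ↦ ?_) (fun i hi1 hi2 ↦ ?_)
    · rwa [iteratedFDerivWithin_of_isOpen n hU₁ hy] at h
    · rw [iteratedFDerivWithin_of_isOpen i hU₂ (hmaps hy)]
      exact Finset.single_le_sum (f := fun j ↦ ‖iteratedFDeriv ℝ j f (Γ y)‖) (fun j _ ↦ norm_nonneg _)
        (Finset.mem_range.2 (by omega))
    · rw [iteratedFDerivWithin_of_isOpen i hU₁ hy]
      exact hBΓ i hi1 (by omega) y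
  -- bound each Leibniz term by the same constant
  have hterm : ∀ i ∈ Finset.range (m + 1),
      (m.choose i : ℝ) * ‖iteratedFDerivWithin ℝ i Λ U₁ y‖ * ‖iteratedFDerivWithin ℝ (m - i) g U₁ y‖ ≤
        2 ^ m * A * (m ! * Cf * B ^ m) := fun i hi ↦ by
    have him : i ≤ m := Nat.lt_succ_iff.1 (Finset.mem_range.1 hi)
    rw [iteratedFDerivWithin_of_isOpen i hU₁ hy, iteratedFDerivWithin_of_isOpen (m - i) hU₁ hy]
    have h1 : (m.choose i : ℝ) ≤ 2 ^ m := by exact_mod_cast Nat.choose_le_two_pow m i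
    have h2 : ‖iteratedFDeriv ℝ i Λ y‖ ≤ A := hAΛ i (him.trans hm) y
    have h3 : ‖iteratedFDeriv ℝ (m - i) g y‖ ≤ m ! * Cf * B ^ m := by
      refine (hFdB (m - i) (Nat.sub_le m i)).trans ?_
      have hf1 : ((m - i)! : ℝ) ≤ m ! := by exact_mod_cast Nat.factorial_le (Nat.sub_le m i)
      have hb1 : B ^ (m - i) ≤ B ^ m := pow_le_pow_right₀ hB (Nat.sub_le m i)
      have hB0 : 0 ≤ B := zero_le_one.trans hB
      calc ((m - i)! : ℝ) * Cf * B ^ (m - i) ≤ m ! * Cf * B ^ (m - i) :=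
            mul_le_mul_of_nonneg_right (mul_le_mul_of_nonneg_right hf1 hCf0) (pow_nonneg hB0 _)
        _ ≤ m ! * Cf * B ^ m := mul_le_mul_of_nonneg_left hb1 (mul_nonneg (by positivity) hCf0)
    exact mul_le_mul (mul_le_mul h1 h2 (norm_nonneg _) (by positivity)) h3 (norm_nonneg _)
      (mul_nonneg (by positivity) hA)
  have hsum : ∑ i ∈ Finset.range (m + 1),
      (m.choose i : ℝ) * ‖iteratedFDerivWithin ℝ i Λ U₁ y‖ * ‖iteratedFDerivWithin ℝ (m - i) g U₁ y‖ ≤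
        (m + 1) * (2 ^ m * A * (m ! * Cf * B ^ m)) := by
    have h := Finset.sum_le_card_nsmul _ _ _ hterm
    rwa [Finset.card_range, nsmul_eq_mul, Nat.cast_add, Nat.cast_one] at h
  have hid : ‖ContinuousLinearMap.id ℝ (G →L[ℝ] G)‖ ≤ 1 := ContinuousLinearMap.norm_id_le
  calc ‖iteratedFDeriv ℝ m (fun y ↦ Λ y (f (Γ y))) y‖
      ≤ ‖ContinuousLinearMap.id ℝ (G →L[ℝ] G)‖ * ∑ i ∈ Finset.range (m + 1),
          (m.choose i : ℝ) * ‖iteratedFDerivWithin ℝ i Λ U₁ y‖ * ‖iteratedFDerivWithin ℝ (m - i) g U₁ y‖ :=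
        hLeib
    _ ≤ 1 * ((m + 1) * (2 ^ m * A * (m ! * Cf * B ^ m))) :=
        mul_le_mul hid hsum (Finset.sum_nonneg fun i _ ↦ by positivity) zero_le_one
    _ = A * ((m + 1) * (2 ^ m * (m ! * B ^ m))) * Cf := by ring

end Pointwise

/-! ## §3 The change of variables `x = Γ y` with `|det DΓ| ≥ 1/2` -/
/-- **A change of variables costing a factor `2`**: `∫_S ψ(Γ y) dy ≤ 2 ∫_{Γ(S)} ψ` if `Γ` is differentiable,
injective on the measurable `S`, with `|det DΓ| ≥ 1/2` (`lintegral_image_eq_lintegral_abs_det_fderiv_mul`). [folklore] -/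
theorem lintegral_comp_le_two_mul_lintegral_image {Γ : E3 → E3} {S : Set E3} (hS : MeasurableSet S)
    (hΓd : ∀ y, DifferentiableAt ℝ Γ y) (hinj : InjOn Γ S) (hdet : ∀ y, (1 / 2 : ℝ) ≤ |(fderiv ℝ Γ y).det|)
    (ψ : E3 → ℝ≥0∞) : ∫⁻ y in S, ψ (Γ y) ≤ 2 * ∫⁻ x in Γ '' S, ψ x := by
  have hcv := lintegral_image_eq_lintegral_abs_det_fderiv_mul volume hS
    (fun y _ ↦ (hΓd y).hasFDerivAt.hasFDerivWithinAt) hinj ψ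
  have hhalf : ∫⁻ y in S, ENNReal.ofReal (1 / 2) * ψ (Γ y) ≤ ∫⁻ x in Γ '' S, ψ x := by
    rw [hcv]
    exact lintegral_mono fun y ↦ mul_le_mul' (ENNReal.ofReal_le_ofReal (hdet y)) le_rfl
  rw [lintegral_const_mul' _ _ ENNReal.ofReal_ne_top] at hhalf
  have h2 : (2 : ℝ≥0∞) * ENNReal.ofReal (1 / 2) = 1 := by
    rw [← ENNReal.ofReal_ofNat 2, ← ENNReal.ofReal_mul (by norm_num)]
    norm_num
  calc ∫⁻ y in S, ψ (Γ y) = 2 * (ENNReal.ofReal (1 / 2) * ∫⁻ y in S, ψ (Γ y)) := by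
        rw [← mul_assoc, h2, one_mul]
    _ ≤ 2 * ∫⁻ x in Γ '' S, ψ x := mul_le_mul' le_rfl hhalf

/-! ## §4 The transport estimate -/
/-- **Weighted Sobolev seminorms under compactly supported transport** (see the module docstring): for
`s, δ, 0 < R ≤ R', 1 ≤ B, 0 ≤ A` one constant `K > 0` serves all `U₁, U₂, Γ, Λ, f` as described there,
`‖y ↦ Λ(y) f(Γ y)‖_{H^s_δ(U₁)} ≤ K ‖f‖_{H^s_δ(U₂)}`. Bartnik 1986, (1.2) (the weighted classes are invariant under
compactly supported changes of the asymptotic structure). [cite: Bartnik1986, (1.2)] -/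
theorem weightedSobolevSeminorm_transport_le (s : ℕ) (δ : ℝ) {R R' B A : ℝ} (hR : 0 < R) (hRR' : R ≤ R')
    (hB : 1 ≤ B) (hA : 0 ≤ A) :
    ∃ K : ℝ, 0 < K ∧ ∀ (U₁ U₂ : Set E3), IsOpen U₁ → IsOpen U₂ →
      ∀ (Γ : E3 → E3), ContDiff ℝ ∞ Γ → (∀ y, R ≤ ‖y‖ → Γ y = y) → MapsTo Γ U₁ U₂ → InjOn Γ U₁ →
      (∀ i, 1 ≤ i → i ≤ s → ∀ y, ‖iteratedFDeriv ℝ i Γ y‖ ≤ B ^ i) →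
      (∀ y, (1 / 2 : ℝ) ≤ |(fderiv ℝ Γ y).det|) → (∀ y, ‖y‖ ≤ R → ‖Γ y‖ ≤ R') →
      ∀ (Λ : E3 → G →L[ℝ] G), ContDiff ℝ ∞ Λ → (∀ y, R ≤ ‖y‖ → Λ y = ContinuousLinearMap.id ℝ G) →
      (∀ i, i ≤ s → ∀ y, ‖iteratedFDeriv ℝ i Λ y‖ ≤ A) →
      ∀ (f : E3 → G), ContDiffOn ℝ ∞ f U₂ →
      weightedSobolevSeminorm U₁ s δ (fun y ↦ Λ y (f (Γ y))) ≤
        ENNReal.ofReal K * weightedSobolevSeminorm U₂ s δ f := by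
  -- the constants
  set P : ℝ := 2 * |δ| + 2 * s with hP
  have hP0 : 0 ≤ P := by positivity
  set Wmax : ℝ := (1 + R) ^ P with hWmax
  set wmin : ℝ := (1 + R') ^ (-P) with hwmin
  have hR' : 0 < R' := hR.trans_le hRR'
  have hWmax0 : 0 < Wmax := Real.rpow_pos_of_pos (by linarith) _
  have hwmin0 : 0 < wmin := Real.rpow_pos_of_pos (by linarith) _
  set K₁ : ℝ := A * ((s + 1) * (2 ^ s * (s ! * B ^ s))) with hK₁
  have hK₁0 : 0 ≤ K₁ := by positivity
  set Cnear : ℝ := Wmax * (K₁ ^ 2 * (s + 1)) * (2 * wmin⁻¹) with hCnear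
  have hCnear0 : 0 ≤ Cnear := by positivity
  set Ktot : ℝ := 1 + (s + 1) * Cnear with hKtot
  have hKtot0 : 0 < Ktot := by positivity
  refine ⟨Real.sqrt Ktot, Real.sqrt_pos.2 hKtot0, ?_⟩
  intro U₁ U₂ hU₁ hU₂ Γ hΓs hΓfix hmaps hinj hBΓ hdet hΓR Λ hΛs hΛfix hAΛ f hf
  -- notation for the integrands
  set F : E3 → G := fun y ↦ Λ y (f (Γ y)) with hF
  set φ₁ : ℕ → E3 → ℝ≥0∞ := fun m y ↦
    ENNReal.ofReal ((1 + ‖y‖) ^ (2 * (δ + m) : ℝ) * ‖iteratedFDeriv ℝ m F y‖ ^ 2) with hφ₁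
  set φ₂ : ℕ → E3 → ℝ≥0∞ := fun m x ↦
    ENNReal.ofReal ((1 + ‖x‖) ^ (2 * (δ + m) : ℝ) * ‖iteratedFDeriv ℝ m f x‖ ^ 2) with hφ₂
  set I₂ : ℕ → ℝ≥0∞ := fun m ↦ ∫⁻ x in U₂, φ₂ m x with hI₂
  have hΓd : ∀ y, DifferentiableAt ℝ Γ y := fun y ↦ hΓs.differentiable (by simp) y
  -- the weight exponents are at most `P` in absolute value
  have habsP : ∀ m, m ≤ s → |(2 * (δ + m) : ℝ)| ≤ P := fun m hm ↦ by
    have hms : (m : ℝ) ≤ s := by exact_mod_cast hm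
    calc |(2 * (δ + m) : ℝ)| = 2 * |δ + m| := by rw [abs_mul, abs_two]
      _ ≤ 2 * (|δ| + m) := by
          gcongr
          exact (abs_add_le _ _).trans (by rw [Nat.abs_cast])
      _ ≤ P := by rw [hP]; linarith
  have hWle : ∀ m, m ≤ s → ∀ y : E3, ‖y‖ ≤ R → (1 + ‖y‖) ^ (2 * (δ + m) : ℝ) ≤ Wmax := fun m hm y hy ↦
    (one_add_norm_rpow_le_of_norm_le hR.le hy _).trans
      (Real.rpow_le_rpow_of_exponent_le (by linarith) (habsP m hm))
  have hwle : ∀ m, m ≤ s → ∀ x : E3, ‖x‖ ≤ R' → wmin ≤ (1 + ‖x‖) ^ (2 * (δ + m) : ℝ) := fun m hm x hx ↦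
    (Real.rpow_le_rpow_of_exponent_le (by linarith) (neg_le_neg (habsP m hm))).trans
      (rpow_neg_abs_le_one_add_norm_rpow hR'.le hx _)
  -- (a) far part: on `U₁ ∩ {R < ‖y‖}` the integrands agree, and that set lies in `U₂`
  have hfar : ∀ m, ∫⁻ y in U₁ ∩ {y | R < ‖y‖}, φ₁ m y ≤ I₂ m := fun m ↦ by
    have hOm : MeasurableSet (U₁ ∩ {y : E3 | R < ‖y‖}) :=
      hU₁.measurableSet.inter (isOpen_lt continuous_const continuous_norm).measurableSet
    calc ∫⁻ y in U₁ ∩ {y | R < ‖y‖}, φ₁ m y = ∫⁻ y in U₁ ∩ {y | R < ‖y‖}, φ₂ m y := by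
          refine setLIntegral_congr_fun hOm fun y hy ↦ ?_
          simp only [hφ₁, hφ₂, hF]
          rw [iteratedFDeriv_transport_eq_of_lt_norm hΓfix hΛfix hy.2 m]
      _ ≤ I₂ m := lintegral_mono_set fun y hy ↦ by
          have h := hmaps hy.1
          rwa [hΓfix y (le_of_lt hy.2)] at h
  -- (b) near part, pointwise
  have hnear_pt : ∀ m, m ≤ s → ∀ y ∈ U₁ ∩ closedBall (0 : E3) R,
      φ₁ m y ≤ ENNReal.ofReal (Wmax * (K₁ ^ 2 * (s + 1))) *
        ∑ j ∈ Finset.range (s + 1), ENNReal.ofReal (‖iteratedFDeriv ℝ j f (Γ y)‖ ^ 2) := by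
    intro m hm y hy
    have hyR : ‖y‖ ≤ R := by simpa using hy.2
    have hD := norm_iteratedFDeriv_transport_le hU₁ hU₂ hΓs hmaps hB hBΓ hΛs hA hAΛ hf hy.1 hm
    -- enlarge the constant and the range of the sum to `s`
    have hKm : A * ((m + 1) * (2 ^ m * (m ! * B ^ m))) ≤ K₁ := by
      rw [hK₁]
      have hms : (m : ℝ) + 1 ≤ s + 1 := by exact_mod_cast Nat.succ_le_succ hm
      have h2 : (2 : ℝ) ^ m ≤ 2 ^ s := pow_le_pow_right₀ one_le_two hm
      have h3 : (m ! : ℝ) ≤ s ! := by exact_mod_cast Nat.factorial_le hm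
      have h4 : B ^ m ≤ B ^ s := pow_le_pow_right₀ hB hm
      gcongr
    set Sm : ℝ := ∑ j ∈ Finset.range (m + 1), ‖iteratedFDeriv ℝ j f (Γ y)‖ with hSm
    set Ss : ℝ := ∑ j ∈ Finset.range (s + 1), ‖iteratedFDeriv ℝ j f (Γ y)‖ ^ 2 with hSs
    have hSm0 : 0 ≤ Sm := Finset.sum_nonneg fun j _ ↦ norm_nonneg _
    have hSmSs : Sm ^ 2 ≤ (s + 1) * Ss := by
      have h1 := sq_sum_le_card_mul_sum_sq (s := Finset.range (m + 1))
        (f := fun j ↦ ‖iteratedFDeriv ℝ j f (Γ y)‖)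
      rw [Finset.card_range] at h1
      have h2 : ∑ j ∈ Finset.range (m + 1), ‖iteratedFDeriv ℝ j f (Γ y)‖ ^ 2 ≤ Ss :=
        Finset.sum_le_sum_of_subset_of_nonneg (Finset.range_mono (by omega)) fun j _ _ ↦ sq_nonneg _
      have h3 : ((m + 1 : ℕ) : ℝ) ≤ s + 1 := by exact_mod_cast Nat.succ_le_succ hm
      calc Sm ^ 2 ≤ ((m + 1 : ℕ) : ℝ) * ∑ j ∈ Finset.range (m + 1), ‖iteratedFDeriv ℝ j f (Γ y)‖ ^ 2 := h1
        _ ≤ (s + 1) * Ss := mul_le_mul h3 h2 (Finset.sum_nonneg fun j _ ↦ sq_nonneg _) (by positivity)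
    have hDsq : ‖iteratedFDeriv ℝ m F y‖ ^ 2 ≤ K₁ ^ 2 * (s + 1) * Ss := by
      have h1 : ‖iteratedFDeriv ℝ m F y‖ ≤ K₁ * Sm := hD.trans (mul_le_mul_of_nonneg_right hKm hSm0)
      calc ‖iteratedFDeriv ℝ m F y‖ ^ 2 ≤ (K₁ * Sm) ^ 2 := pow_le_pow_left₀ (norm_nonneg _) h1 2
        _ = K₁ ^ 2 * Sm ^ 2 := by ring
        _ ≤ K₁ ^ 2 * ((s + 1) * Ss) := mul_le_mul_of_nonneg_left hSmSs (sq_nonneg _)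
        _ = _ := by ring
    have hw := hWle m hm y hyR
    have hSs0 : 0 ≤ Ss := Finset.sum_nonneg fun j _ ↦ sq_nonneg _
    calc φ₁ m y ≤ ENNReal.ofReal (Wmax * (K₁ ^ 2 * (s + 1) * Ss)) := by
          refine ENNReal.ofReal_le_ofReal ?_
          exact mul_le_mul hw hDsq (sq_nonneg _) hWmax0.le
      _ = ENNReal.ofReal (Wmax * (K₁ ^ 2 * (s + 1))) * ENNReal.ofReal Ss := by
          rw [← ENNReal.ofReal_mul (by positivity)]
          congr 1
          ring
      _ = _ := by rw [hSs, ENNReal.ofReal_sum_of_nonneg fun j _ ↦ sq_nonneg _]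
  -- (c) near part, integrated: change of variables and weights from below
  have hnear_int : ∀ j, j ≤ s →
      ∫⁻ y in U₁ ∩ closedBall (0 : E3) R, ENNReal.ofReal (‖iteratedFDeriv ℝ j f (Γ y)‖ ^ 2) ≤
        2 * (ENNReal.ofReal wmin⁻¹ * I₂ j) := fun j hj ↦ by
    have hSm : MeasurableSet (U₁ ∩ closedBall (0 : E3) R) := hU₁.measurableSet.inter measurableSet_closedBall
    have h1 := lintegral_comp_le_two_mul_lintegral_image hSm hΓd (hinj.mono inter_subset_left) hdet
      (fun x ↦ ENNReal.ofReal (‖iteratedFDeriv ℝ j f x‖ ^ 2))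
    refine h1.trans (mul_le_mul' le_rfl ?_)
    -- `Γ(U₁ ∩ B̄_R) ⊆ U₂ ∩ B̄_{R'}`, where the weight is at least `wmin`
    have hsub : Γ '' (U₁ ∩ closedBall (0 : E3) R) ⊆ U₂ ∩ closedBall (0 : E3) R' := by
      rintro _ ⟨y, hy, rfl⟩
      exact ⟨hmaps hy.1, by simpa using hΓR y (by simpa using hy.2)⟩
    have hTm : MeasurableSet (U₂ ∩ closedBall (0 : E3) R') := hU₂.measurableSet.inter measurableSet_closedBall
    calc ∫⁻ x in Γ '' (U₁ ∩ closedBall (0 : E3) R), ENNReal.ofReal (‖iteratedFDeriv ℝ j f x‖ ^ 2)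
        ≤ ∫⁻ x in U₂ ∩ closedBall (0 : E3) R', ENNReal.ofReal (‖iteratedFDeriv ℝ j f x‖ ^ 2) :=
          lintegral_mono_set hsub
      _ ≤ ∫⁻ x in U₂ ∩ closedBall (0 : E3) R', ENNReal.ofReal wmin⁻¹ * φ₂ j x := by
          refine setLIntegral_mono' hTm fun x hx ↦ ?_
          have hxR : ‖x‖ ≤ R' := by simpa using hx.2
          have hw := hwle j hj x hxR
          rw [hφ₂, ← ENNReal.ofReal_mul (inv_nonneg.2 hwmin0.le)]
          refine ENNReal.ofReal_le_ofReal ?_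
          have hw0 : 0 < (1 + ‖x‖) ^ (2 * (δ + j) : ℝ) := Real.rpow_pos_of_pos (by positivity) _
          calc ‖iteratedFDeriv ℝ j f x‖ ^ 2
              = wmin⁻¹ * (wmin * ‖iteratedFDeriv ℝ j f x‖ ^ 2) := by
                rw [← mul_assoc, inv_mul_cancel₀ hwmin0.ne', one_mul]
            _ ≤ wmin⁻¹ * ((1 + ‖x‖) ^ (2 * (δ + j) : ℝ) * ‖iteratedFDeriv ℝ j f x‖ ^ 2) :=
                mul_le_mul_of_nonneg_left (mul_le_mul_of_nonneg_right hw (sq_nonneg _))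
                  (inv_nonneg.2 hwmin0.le)
      _ = ENNReal.ofReal wmin⁻¹ * ∫⁻ x in U₂ ∩ closedBall (0 : E3) R', φ₂ j x :=
          lintegral_const_mul' _ _ ENNReal.ofReal_ne_top
      _ ≤ ENNReal.ofReal wmin⁻¹ * I₂ j := mul_le_mul' le_rfl (lintegral_mono_set inter_subset_left)
  -- (d) the near part of the `m`-th term
  have hnear : ∀ m, m ≤ s → ∫⁻ y in U₁ ∩ closedBall (0 : E3) R, φ₁ m y ≤
      ENNReal.ofReal Cnear * ∑ j ∈ Finset.range (s + 1), I₂ j := fun m hm ↦ by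
    have hSm : MeasurableSet (U₁ ∩ closedBall (0 : E3) R) := hU₁.measurableSet.inter measurableSet_closedBall
    -- measurability of the summands on the set (continuity on `U₁`)
    have hmeas : ∀ j ∈ Finset.range (s + 1), AEMeasurable
        (fun y ↦ ENNReal.ofReal (‖iteratedFDeriv ℝ j f (Γ y)‖ ^ 2))
        (volume.restrict (U₁ ∩ closedBall (0 : E3) R)) := fun j _ ↦ by
      have hc : ContinuousOn (fun y ↦ ENNReal.ofReal (‖iteratedFDeriv ℝ j f (Γ y)‖ ^ 2)) U₁ :=
        ENNReal.continuous_ofReal.comp_continuousOn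
          ((((continuousOn_iteratedFDeriv_of_isOpen hU₂ hf j).comp hΓs.continuous.continuousOn
            hmaps).norm).pow 2)
      exact (hc.mono inter_subset_left).aemeasurable hSm
    calc ∫⁻ y in U₁ ∩ closedBall (0 : E3) R, φ₁ m y
        ≤ ∫⁻ y in U₁ ∩ closedBall (0 : E3) R, ENNReal.ofReal (Wmax * (K₁ ^ 2 * (s + 1))) *
            ∑ j ∈ Finset.range (s + 1), ENNReal.ofReal (‖iteratedFDeriv ℝ j f (Γ y)‖ ^ 2) :=
          setLIntegral_mono' hSm (hnear_pt m hm)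
      _ = ENNReal.ofReal (Wmax * (K₁ ^ 2 * (s + 1))) * ∑ j ∈ Finset.range (s + 1),
            ∫⁻ y in U₁ ∩ closedBall (0 : E3) R, ENNReal.ofReal (‖iteratedFDeriv ℝ j f (Γ y)‖ ^ 2) := by
          rw [lintegral_const_mul' _ _ ENNReal.ofReal_ne_top, lintegral_finsetSum' _ hmeas]
      _ ≤ ENNReal.ofReal (Wmax * (K₁ ^ 2 * (s + 1))) * ∑ j ∈ Finset.range (s + 1),
            2 * (ENNReal.ofReal wmin⁻¹ * I₂ j) := by
          gcongr with j hj
          exact hnear_int j (Nat.lt_succ_iff.1 (Finset.mem_range.1 hj))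
      _ = ENNReal.ofReal Cnear * ∑ j ∈ Finset.range (s + 1), I₂ j := by
          have hc : ENNReal.ofReal (Wmax * (K₁ ^ 2 * (s + 1))) * (2 * ENNReal.ofReal wmin⁻¹) =
              ENNReal.ofReal Cnear := by
            rw [hCnear, ENNReal.ofReal_mul (by positivity : (0 : ℝ) ≤ Wmax * (K₁ ^ 2 * (s + 1))),
              ENNReal.ofReal_mul (zero_le_two : (0 : ℝ) ≤ 2), ENNReal.ofReal_ofNat]
          simp_rw [← mul_assoc (2 : ℝ≥0∞)]
          rw [← Finset.mul_sum, ← mul_assoc, hc]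
  -- (e) the `m`-th term: split `U₁` into the far and the near part
  have hterm : ∀ m, m ≤ s → ∫⁻ y in U₁, φ₁ m y ≤ I₂ m + ENNReal.ofReal Cnear * ∑ j ∈ Finset.range (s + 1), I₂ j :=
    fun m hm ↦ by
    have hsplit : U₁ = (U₁ ∩ {y | R < ‖y‖}) ∪ (U₁ ∩ closedBall (0 : E3) R) := by
      ext y
      simp only [mem_union, mem_inter_iff, mem_setOf_eq, mem_closedBall, dist_zero_right]
      constructor
      · intro hy
        rcases lt_or_ge R ‖y‖ with h | h
        · exact Or.inl ⟨hy, h⟩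
        · exact Or.inr ⟨hy, h⟩
      · rintro (⟨hy, -⟩ | ⟨hy, -⟩) <;> exact hy
    calc ∫⁻ y in U₁, φ₁ m y = ∫⁻ y in (U₁ ∩ {y | R < ‖y‖}) ∪ (U₁ ∩ closedBall (0 : E3) R), φ₁ m y := by
          rw [← hsplit]
      _ ≤ (∫⁻ y in U₁ ∩ {y | R < ‖y‖}, φ₁ m y) + ∫⁻ y in U₁ ∩ closedBall (0 : E3) R, φ₁ m y :=
          lintegral_union_le _ _ _
      _ ≤ I₂ m + ENNReal.ofReal Cnear * ∑ j ∈ Finset.range (s + 1), I₂ j := add_le_add (hfar m) (hnear m hm)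
  -- (f) sum over `m ≤ s`
  have hsum : ∑ m ∈ Finset.range (s + 1), ∫⁻ y in U₁, φ₁ m y ≤
      ENNReal.ofReal Ktot * ∑ j ∈ Finset.range (s + 1), I₂ j := by
    calc ∑ m ∈ Finset.range (s + 1), ∫⁻ y in U₁, φ₁ m y
        ≤ ∑ m ∈ Finset.range (s + 1), (I₂ m + ENNReal.ofReal Cnear * ∑ j ∈ Finset.range (s + 1), I₂ j) :=
          Finset.sum_le_sum fun m hm ↦ hterm m (Nat.lt_succ_iff.1 (Finset.mem_range.1 hm))
      _ = ∑ m ∈ Finset.range (s + 1), I₂ m +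
            (s + 1 : ℕ) * (ENNReal.ofReal Cnear * ∑ j ∈ Finset.range (s + 1), I₂ j) := by
          rw [Finset.sum_add_distrib, Finset.sum_const, Finset.card_range, nsmul_eq_mul]
      _ = ENNReal.ofReal Ktot * ∑ j ∈ Finset.range (s + 1), I₂ j := by
          have hK : ENNReal.ofReal Ktot = 1 + ((s + 1 : ℕ) : ℝ≥0∞) * ENNReal.ofReal Cnear := by
            rw [hKtot, ENNReal.ofReal_add zero_le_one (by positivity), ENNReal.ofReal_one,
              ENNReal.ofReal_mul (by positivity), show ((s : ℝ) + 1) = ((s + 1 : ℕ) : ℝ) by push_cast; ring,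
              ENNReal.ofReal_natCast]
          rw [hK, add_mul, one_mul, mul_assoc]
  -- (g) square roots
  unfold weightedSobolevSeminorm
  calc (∑ m ∈ Finset.range (s + 1), ∫⁻ y in U₁, ENNReal.ofReal ((1 + ‖y‖) ^ (2 * (δ + m) : ℝ) *
          ‖iteratedFDeriv ℝ m (fun y ↦ Λ y (f (Γ y))) y‖ ^ 2)) ^ (1 / 2 : ℝ)
      ≤ (ENNReal.ofReal Ktot * ∑ j ∈ Finset.range (s + 1), I₂ j) ^ (1 / 2 : ℝ) :=
        ENNReal.rpow_le_rpow hsum (by norm_num)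
    _ = _ := by
        rw [ENNReal.mul_rpow_of_nonneg _ _ (by norm_num : (0 : ℝ) ≤ 1 / 2),
          ENNReal.ofReal_rpow_of_nonneg hKtot0.le (by norm_num), ← Real.sqrt_eq_rpow]


/-- **Registered sub-goal `stub_weightedSobolevSeminorm_transport_le`** (crux item stmt-FinalStateConjecture-14985,
SPIN TRANSPORT package): closed form of `weightedSobolevSeminorm_transport_le` for bilinear-form-valued
functions (the values of `InitialDataSet.hFun`/`kFun`). [cite: Bartnik1986, (1.2)] -/
theorem stub_weightedSobolevSeminorm_transport_le : ∀ (s : ℕ) (δ R R' B A : ℝ), 0 < R → R ≤ R' → 1 ≤ B → 0 ≤ A → ∃ K : ℝ, 0 < K ∧ ∀ (U₁ U₂ : Set E3), IsOpen U₁ → IsOpen U₂ → ∀ (Γ : E3 → E3), ContDiff ℝ ∞ Γ → (∀ y, R ≤ ‖y‖ → Γ y = y) → Set.MapsTo Γ U₁ U₂ → Set.InjOn Γ U₁ → (∀ i, 1 ≤ i → i ≤ s → ∀ y, ‖iteratedFDeriv ℝ i Γ y‖ ≤ B ^ i) → (∀ y, (1 / 2 : ℝ) ≤ |(fderiv ℝ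 Γ y).det|) → (∀ y, ‖y‖ ≤ R → ‖Γ y‖ ≤ R') → ∀ (Λ : E3 → (E3 →L[ℝ] E3 →L[ℝ] ℝ) →L[ℝ] (E3 →L[ℝ] E3 →L[ℝ] ℝ)), ContDiff ℝ ∞ Λ → (∀ y, R ≤ ‖y‖ → Λ y = ContinuousLinearMap.id ℝ (E3 →L[ℝ] E3 →L[ℝ] ℝ)) → (∀ i, i ≤ s → ∀ y, ‖iteratedFDeriv ℝ i Λ y‖ ≤ A) → ∀ (f : E3 → (E3 →L[ℝ] E3 →L[ℝ] ℝ)), ContDiffOn ℝ ∞ f U₂ → weightedSobolevSeminorm U₁ s δ (fun y ↦ Λ y (f (Γ y))) ≤ ENNReal.ofReal K * weightedSobolevSeminorm U₂ s δ f :=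
  fun s δ _ _ _ _ hR hRR' hB hA ↦ weightedSobolevSeminorm_transport_le s δ hR hRR' hB hA

end Summit.FinalStateConjecture.FinalStateConjecture.Theorems.BulkKerrCaptureC2.SpinTransport

end
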